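import Summits.QuantumFields.YangMills.Theorems.ParabolicTrajectoryLatticeGapOnTrajectorySplitDefs
import Literature.MathematicalPhysics.QuantumLattice.GaugeGroupsProofs

/-!
# `LatticeGapOnTrajectory` — negative-side support: the two residual sub-statements of the filed text

Support file for crux `stmt-QuantumFields-10523` (`ParabolicTrajectory.LatticeGapOnTrajectory`, conjunct (B)),
line lead c6 (2026-08-17), kernel-checking the status of the two RESIDUAL stubs that every line of rounds 1–2
carries in order to reach the filed decl through the landed decomposition
`Split.latticeGapOnTrajectory_of_subs : Sub₁ → VolumeGrowthOnTrajectory → SymmetrisationOnTrajectory →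
LatticeGapOnTrajectory` (p124272):

* `exists_dyadic_weakCoupling_not_hasVolumeGrowth`: a `SpeciesScheme` of dyadic shape `a_k = 2^{-k}` with
  `β_k → +∞` and `a_k L_k = k + 1 → ∞` whose physical volume does NOT outgrow the log of the cutoff
  (`a_k L_k / log(a_k⁻¹) = (k+1)/(k log 2) ≤ 2/log 2`): the clause `SpeciesScheme.HasVolumeGrowth` is independent
  of the scheme axioms, the `M`-adic shape and the weak-coupling clause.
* `volumeGrowth_false_without_tuning`: consequently the volume residual with the tuning hypothesis
  `a_k⁻⁸⟨P ; τ_{1/a_k} P⟩ → θ` deleted is FALSE (witness: `SU(2)`, any lattice representation, the dyadic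
  scheme) — any derivation of `Split.VolumeGrowthOnTrajectory` would have to extract the torus size from the
  unit-scale tuning condition alone.
* `exists_tuned_of_not_volumeGrowthOnTrajectory`, `exists_tuned_of_not_symmetrisationOnTrajectory`: conversely a
  refutation of either residual exhibits a compact simple `G` and an `M`-adic Wilson scheme with `β_k → ∞` tuned to
  some `θ > 0` — the `∃`-core of the route's conjunct (S), rated open — so neither residual is Lean-refutable today.

Together with the landed symmetric transfer (`Transfer.transferHalfSym_of_uniformSlabClustering`, p121787/p120012)
this is the formal content of the leads' verdict "(B) as filed is mis-stated at (α) and lacks (β)": the residuals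
are neither claimed by any line nor refutable, and the repaired text `Split.LatticeGapOnTrajectoryRV` deletes both.
Tree objects only, nothing posited.
-/

namespace Summit.QuantumFields.YangMills.Theorems.LatticeGapOnTrajectory.Negative

open Filter Topology MeasureTheory
open Literature.MathematicalPhysics.QuantumFieldTheory Literature.MathematicalPhysics.QuantumLattice
open Summit.QuantumFields.YangMills.Cruxes.LatticeGapOnTrajectory.OrbitKantorovichFiniteSize

noncomputable section

/-- **A dyadic weak-coupling scheme without volume growth.** There is a species scheme with `a_k = 2^{-k}`,
`β_k = k → +∞`, `L_k = 2^k (k+1)` (so `a_k L_k = k+1 → ∞`, as the type demands) for which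
`a_k L_k / log(a_k⁻¹) = (k+1)/(k log 2)` stays below `2 / log 2`: `HasVolumeGrowth` fails. [folklore] -/
theorem exists_dyadic_weakCoupling_not_hasVolumeGrowth (ι : Type) :
    ∃ sch : SpeciesScheme ι, (∀ k, sch.a k = (((2 : ℕ) : ℝ) ^ (id k))⁻¹) ∧ Tendsto sch.β atTop atTop ∧
      ¬ sch.HasVolumeGrowth := by
  have hL : Tendsto (fun k : ℕ => ((2 : ℝ) ^ k)⁻¹ * ((2 ^ k * (k + 1) : ℕ) : ℝ)) atTop atTop := by
    have h : (fun k : ℕ => ((2 : ℝ) ^ k)⁻¹ * ((2 ^ k * (k + 1) : ℕ) : ℝ)) = fun k : ℕ => (k : ℝ) + 1 := by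
      funext k; push_cast; field_simp
    rw [h]
    exact tendsto_natCast_atTop_atTop.atTop_add tendsto_const_nhds
  refine ⟨{ a := fun k => ((2 : ℝ) ^ k)⁻¹
            a_pos := fun k => by positivity
            tendsto_a := tendsto_inv_atTop_zero.comp (tendsto_pow_atTop_atTop_of_one_lt one_lt_two)
            β := fun k => k
            L := fun k => 2 ^ k * (k + 1)
            tendsto_L := hL
            c := fun _ _ => 0
            m := fun _ _ => 0 }, fun k => by simp, tendsto_natCast_atTop_atTop, ?_⟩
  intro h
  have hlog : 0 < Real.log 2 := Real.log_pos one_lt_two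
  -- the ratio, computed
  have hratio : ∀ k : ℕ, ((2 : ℝ) ^ k)⁻¹ * ((2 ^ k * (k + 1) : ℕ) : ℝ) / Real.log (((2 : ℝ) ^ k)⁻¹)⁻¹ =
      ((k : ℝ) + 1) / (k * Real.log 2) := by
    intro k
    have h1 : ((2 : ℝ) ^ k)⁻¹ * ((2 ^ k * (k + 1) : ℕ) : ℝ) = (k : ℝ) + 1 := by
      push_cast; field_simp
    rw [h1, inv_inv, Real.log_pow]
  have hbound : ∀ k : ℕ, 1 ≤ k →
      ((2 : ℝ) ^ k)⁻¹ * ((2 ^ k * (k + 1) : ℕ) : ℝ) / Real.log (((2 : ℝ) ^ k)⁻¹)⁻¹ ≤ 2 / Real.log 2 := by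
    intro k hk
    rw [hratio]
    have hk' : (1 : ℝ) ≤ k := by exact_mod_cast hk
    rw [div_le_div_iff₀ (by positivity) hlog]
    nlinarith
  have hev := h.eventually_ge_atTop (2 / Real.log 2 + 1)
  obtain ⟨k, hk1, hk2⟩ := (hev.and (eventually_ge_atTop 1)).exists
  have := hbound k hk2
  exact absurd (hk1.trans this) (by linarith)

/-- **The volume residual is false without the tuning hypothesis.** Deleting the tuning clause
`a_k⁻⁸⟨P ; τ_{1/a_k} P⟩ → θ` (and `θ`) from `Split.VolumeGrowthOnTrajectory` leaves a false statement: at `G = SU(2)`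
(compact simple, `isCompactSimpleLieGroup_specialUnitaryGroup`), any lattice representation, `M = 2`, `n = id` and
the dyadic scheme of `exists_dyadic_weakCoupling_not_hasVolumeGrowth`, every remaining hypothesis holds and the
conclusion fails. So the tuning condition — a statement about one correlator at physical separation `1` — is the only
hypothesis of the residual that could ever produce the torus-size clause. [folklore] -/
theorem volumeGrowth_false_without_tuning :
    ¬ (∀ (G : Type) [Group G] [TopologicalSpace G] [IsTopologicalGroup G] [CompactSpace G]
        [MeasurableSpace G] [BorelSpace G], IsCompactSimpleLieGroup G →
        ∀ (r : LatticeRep G) (M : ℕ) (sch : SpeciesScheme (YMSpecies G)) (n : ℕ → ℕ),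
          2 ≤ M → (∀ k, sch.a k = ((M : ℝ) ^ n k)⁻¹) → Tendsto sch.β atTop atTop → sch.HasVolumeGrowth) := by
  intro h
  have hG : IsCompactSimpleLieGroup (Matrix.specialUnitaryGroup (Fin 2) ℂ) :=
    isCompactSimpleLieGroup_specialUnitaryGroup isSimpleCompactGroup_specialUnitaryGroup_holds le_rfl
  letI : MeasurableSpace (Matrix.specialUnitaryGroup (Fin 2) ℂ) := borel _
  haveI : BorelSpace (Matrix.specialUnitaryGroup (Fin 2) ℂ) := ⟨rfl⟩
  obtain ⟨r⟩ := hG.2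
  obtain ⟨sch, hshape, hβ, hvol⟩ :=
    exists_dyadic_weakCoupling_not_hasVolumeGrowth (YMSpecies (Matrix.specialUnitaryGroup (Fin 2) ℂ))
  exact hvol (h _ hG r 2 sch id le_rfl hshape hβ)

/-- **Refuting the volume residual exhibits a tuned weak-coupling Wilson sequence**: from
`¬ Split.VolumeGrowthOnTrajectory` one extracts a compact simple `G`, a lattice representation and an `M`-adic
scheme with `β_k → ∞` tuned to some `θ > 0` — the `∃`-core of the route's conjunct (S) (`TunedSequenceExists`),
rated open; so the residual is not Lean-refutable short of that construction. [folklore] -/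
theorem exists_tuned_of_not_volumeGrowthOnTrajectory (h : ¬ Split.VolumeGrowthOnTrajectory) :
    ∃ (G : Type) (_ : Group G) (_ : TopologicalSpace G) (_ : IsTopologicalGroup G) (_ : CompactSpace G)
      (_ : MeasurableSpace G) (_ : BorelSpace G), IsCompactSimpleLieGroup G ∧
      ∃ (r : LatticeRep G) (M : ℕ) (θ : ℝ) (sch : SpeciesScheme (YMSpecies G)) (n : ℕ → ℕ),
        2 ≤ M ∧ 0 < θ ∧ (∀ k, sch.a k = ((M : ℝ) ^ n k)⁻¹) ∧ Tendsto sch.β atTop atTop ∧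
        Tendsto (fun k => ((M : ℝ) ^ n k) ^ 8 *
          latticeConnectedCorr r.ρ (sch.β k) (sch.side k) r.curvature.F r.curvature.F (M ^ n k))
          atTop (𝓝 θ) ∧ ¬ sch.HasVolumeGrowth := by
  by_contra hne
  apply h
  intro G _ _ _ _ _ _ hG r M θ sch n hM hθ hs hβ ht
  by_contra hv
  exact hne ⟨G, _, _, _, _, _, _, hG, r, M, θ, sch, n, hM, hθ, hs, hβ, ht, hv⟩

/-- **Refuting the symmetrisation residual likewise exhibits a tuned weak-coupling Wilson sequence** (together
with a rate `Δ > 0` at which the symmetric transfer clause holds while the filed all-`sch'` clause fails at every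
rate): `¬ Split.SymmetrisationOnTrajectory` yields the same `∃`-core of (S); so residual (α), whose positive side is
blocked by the witness-ratio obstruction (`Negative/TransferObstruction.lean`), is not Lean-refutable either short
of a tuned sequence carrying a non-clustering asymmetric continuum limit. [folklore] -/
theorem exists_tuned_of_not_symmetrisationOnTrajectory (h : ¬ Split.SymmetrisationOnTrajectory) :
    ∃ (G : Type) (_ : Group G) (_ : TopologicalSpace G) (_ : IsTopologicalGroup G) (_ : CompactSpace G)
      (_ : MeasurableSpace G) (_ : BorelSpace G), IsCompactSimpleLieGroup G ∧
      ∃ (r : LatticeRep G) (M : ℕ) (θ : ℝ) (sch : SpeciesScheme (YMSpecies G)) (n : ℕ → ℕ),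
        2 ≤ M ∧ 0 < θ ∧ (∀ k, sch.a k = ((M : ℝ) ^ n k)⁻¹) ∧ Tendsto sch.β atTop atTop ∧
        Tendsto (fun k => ((M : ℝ) ^ n k) ^ 8 *
          latticeConnectedCorr r.ρ (sch.β k) (sch.side k) r.curvature.F r.curvature.F (M ^ n k))
          atTop (𝓝 θ) ∧
        ∃ Δ : ℝ, 0 < Δ ∧ Transfer.TransferHalfSym r sch Δ ∧ ∀ Δ' : ℝ, 0 < Δ' → ¬ TransferHalf r sch Δ' := by
  by_contra hne
  apply h
  intro G _ _ _ _ _ _ hG r M θ sch n hM hθ hs hβ ht Δ hΔ hsym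
  by_contra hv
  push Not at hv
  exact hne ⟨G, _, _, _, _, _, _, hG, r, M, θ, sch, n, hM, hθ, hs, hβ, ht, Δ, hΔ, hsym, hv⟩

end

end Summit.QuantumFields.YangMills.Theorems.LatticeGapOnTrajectory.Negative
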